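import Mathlib
import HarnessLib
import Summits.HubbardSuperconductivity.HubbardSuperconductivity.Theorems.KLProgrammeH10TwoPointLimitPerturbedCountShift

/-!
# Route `KLProgramme` — K3 engine child `KLRegimeEngineV17F2` (stmt-HubbardSuperconductivity-20437), stub (b) import ι₂:
# the Cooper range ON THE PERTURBED CURVE at the THIN (shift-affine) tolerance — no multiplicative `log N`

Cell gate-hubbard-kl, plan g17 (R41)(i) «E1-P2-THIN-COUNT» (seat p4; plan HOME/prover-p4/E1-P2-THIN-COUNT-PLAN.md §Refinement 3).  This is the
perturbed-curve twin (`hfunE δ u μ P`, the (β)-port of `KLProgrammeH10TwoPointLimitPerturbedCount*.lean`) of the Literature lemma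
`BandSectorCounting.count_odd_total_affine` (`ThinSectorCooperRange`): the landed per-shift count `count_odd_shift_perturbed` is run VERBATIM at the
shift-dependent tolerance `δ_k = δ₀ + δ₁·|kw − π|` (`δ₀ ≍ w²`, `δ₁ ≍ w`, supplied by `ThinSectorCount.abs_level3_le_thin` instantiated on the frame curve)
and summed: the `δ₀`-part gives the harmonic `(2δ₀/((h_min/2)w))·2(1 + log N)/w` (an ADDITIVE `O(log N)` at `δ₀ ≍ w²`), the `δ₁`-part a plain
`(2δ₁/((h_min/2)w))·N = O(N)`; the exact Cooper shift `k = N_h` contributes at most `N`.  Constants expanded exactly as in `count_odd_total_perturbed`.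

* `count_odd_total_affine_perturbed` — `Σ_{|kw−π| ≤ τ} #{a : |h^E(θ_a, θ_a+kw)| ≤ δ₀ + δ₁|kw−π| ∧ both |∂h^E| < λ} ≤
  N + 2C₅((2δ₀/((h_min/2)w))·2(1+log N)/w + (2δ₁/((h_min/2)w))·N + N)` under `δ₀ + δ₁τ ≤ η₀/2`.

Everything is PROVED; no definitions.  References: BGM 2006 Lemma 3.1 / (2.80) / App. A2 [cite: BenfattoGiulianiMastropietro2006]; Mastropietro 2008
(14.67) p. 223, p. 229 [cite: Mastropietro2008].
-/

noncomputable section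

namespace Summit.HubbardSuperconductivity.HubbardSuperconductivity.Theorems.PerturbedFermiCurve

set_option linter.dupNamespace false -- summit = problem name (single-conjunct summit), D-0017

open Real Set
open Literature.MathematicalPhysics.QuantumLattice Literature.MathematicalPhysics.QuantumLattice.BandSectorCounting
open Summit.HubbardSuperconductivity.HubbardSuperconductivity.Theorems.CountPairsOffset

section ShiftThin

variable {a b : ℝ} (B : BandBounds a b) {δ : (Fin 2 → ℝ) → ℝ} (hδs : ContDiff ℝ 2 δ) (heven : ∀ k, δ (-k) = δ k)
  {κ₀ κ₁ κ₂ μ : ℝ} (hδ : ∀ k : Fin 2 → ℝ, |δ k| ≤ κ₀) (hlo : a ≤ μ - κ₀) (hhi : μ + κ₀ ≤ b)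
  (hκ : ∀ k : Fin 2 → ℝ, ‖fderiv ℝ δ k‖ ≤ κ₁) (hκ₁ : κ₁ < B.Dtmin) (hκ₂ : ∀ k : Fin 2 → ℝ, ‖fderiv ℝ (fderiv ℝ δ) k‖ ≤ κ₂)
  {u : ℝ → ℝ} (hu : ∀ θ, IsBandFermiRadius (μ - δ (u θ • dir θ)) θ (u θ))
include B hδs heven hδ hlo hhi hκ hκ₁ hκ₂ hu

/-- **The Cooper range on the perturbed curve at the shift-affine (THIN) tolerance** `δ_k = δ₀ + δ₁·|kw − π|`:
`Σ_{|kw - π| ≤ τ} #{a : |h^E(θ_a, θ_a + kw)| ≤ δ_k, |∂₃h^E| < λ both orders} ≤ N + 2C₅((2δ₀/((h_min/2) w))·2(1 + log N)/w + (2δ₁/((h_min/2)w))·N + N)`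
— `count_odd_shift_perturbed` verbatim per shift, then the harmonic sum for the `δ₀`-part and a plain count for the `δ₁`-part; with `δ₀ ≍ w²`,
`δ₁ ≍ w` this is `O(N)` plus an ADDITIVE `O(log N)`. [cite: BenfattoGiulianiMastropietro2006, (2.80)] -/
theorem count_odd_total_affine_perturbed {P : ℝ × ℝ} {w δ₀ δ₁ lam τ η₀ : ℝ} (hw : 0 < w) {N Nh : ℕ} (hN : (N : ℝ) * w = 2 * π)
    (hNh : (Nh : ℝ) * w = π) (hNN : N = 2 * Nh) (hδ₀ : 0 < δ₀) (hδ₁ : 0 ≤ δ₁) (hη₀ : 0 < η₀) (hlam : 0 < lam) (hτ : 0 < τ)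
    (hδη : δ₀ + δ₁ * τ ≤ η₀ / 2) (hlo' : a ≤ μ - κ₀ - η₀) (hhi' : μ + κ₀ + η₀ ≤ b)
    (hsmall : 4 * (κ₁ * (π * Real.sqrt 2 + 2 * B.smax) / (B.Dtmin - κ₁)) * ((B.smax + κ₁ * (π * Real.sqrt 2 + 2 * B.smax) / (B.Dtmin - κ₁)) + B.smax) + (κ₂ * (B.smax + κ₁ * (π * Real.sqrt 2 + 2 * B.smax) / (B.Dtmin - κ₁)) ^ 2 + κ₁ * ((((4 + κ₂) * (B.smax + κ₁ * (π * Real.sqrt 2 + 2 * B.smax) / (B.Dtmin - κ₁)) ^ 2 + (8 + 2 * κ₁) * ((4 + κ₁) * (π * Real.sqrt 2) / (B.Dtmin - κ₁)) + (4 + κ₁) * (π * Real.sqrt 2)) / (B.Dtmin - κ₁)) + 2 * ((4 + κ₁) * (π * Real.sqrt 2) / (B.Dtmin - κ₁)) + π * Real.sqrt 2)) / 2 + 2 * ((((4 + κ₂) * (B.smax + κ₁ * (π * Real.sqrt 2 + 2 * B.smax) / (B.Dtmin - κ₁)) ^ 2 + (8 + 2 * κ₁) * ((4 + κ₁) * (π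 * Real.sqrt 2) / (B.Dtmin - κ₁)) + (4 + κ₁) * (π * Real.sqrt 2)) / (B.Dtmin - κ₁)) + 2 * ((4 + κ₁) * (π * Real.sqrt 2) / (B.Dtmin - κ₁)) + π * Real.sqrt 2) * (η₀ / B.Dtmin + 2 * κ₀ / B.Dtmin + B.smax * (B.Cg * (2 * lam / 2 + κ₁ * (B.smax + κ₁ * (π * Real.sqrt 2 + 2 * B.smax) / (B.Dtmin - κ₁)) / 2 + 2 * (κ₁ * (π * Real.sqrt 2 + 2 * B.smax) / (B.Dtmin - κ₁)) + 2 * B.smax * (η₀ / B.Dtmin) + 2 * B.smax * (2 * κ₀ / B.Dtmin)) + τ)) ≤ B.hmin / 2)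
    (hκA : κ₁ * ((((4 + κ₂) * (B.smax + κ₁ * (π * Real.sqrt 2 + 2 * B.smax) / (B.Dtmin - κ₁)) ^ 2 + (8 + 2 * κ₁) * ((4 + κ₁) * (π * Real.sqrt 2) / (B.Dtmin - κ₁)) + (4 + κ₁) * (π * Real.sqrt 2)) / (B.Dtmin - κ₁)) + 2 * ((4 + κ₁) * (π * Real.sqrt 2) / (B.Dtmin - κ₁)) + π * Real.sqrt 2) ≤ B.hmin / 2) (hAE : 0 < ((((4 + κ₂) * (B.smax + κ₁ * (π * Real.sqrt 2 + 2 * B.smax) / (B.Dtmin - κ₁)) ^ 2 + (8 + 2 * κ₁) * ((4 + κ₁) * (π * Real.sqrt 2) / (B.Dtmin - κ₁)) + (4 + κ₁) * (π * Real.sqrt 2)) / (B.Dtmin - κ₁)) + 2 * ((4 + κ₁) * (π * Real.sqrt 2) / (B.Dtmin - κ₁)) + π * Real.sqrt 2)) (hMΓ : 0 < (8 * (B.smax + κ₁ * (π * Real.sqrt 2 + 2 * B.smax) / (B.Dtmin - κ₁)) ^ 2 + 2 * (κ₂ * (B.smax + κ₁ * (π * Real.sqrt 2 + 2 * B.smax)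 / (B.Dtmin - κ₁)) ^ 2) + 4 * ((((4 + κ₂) * (B.smax + κ₁ * (π * Real.sqrt 2 + 2 * B.smax) / (B.Dtmin - κ₁)) ^ 2 + (8 + 2 * κ₁) * ((4 + κ₁) * (π * Real.sqrt 2) / (B.Dtmin - κ₁)) + (4 + κ₁) * (π * Real.sqrt 2)) / (B.Dtmin - κ₁)) + 2 * ((4 + κ₁) * (π * Real.sqrt 2) / (B.Dtmin - κ₁)) + π * Real.sqrt 2) + κ₁ * ((((4 + κ₂) * (B.smax + κ₁ * (π * Real.sqrt 2 + 2 * B.smax) / (B.Dtmin - κ₁)) ^ 2 + (8 + 2 * κ₁) * ((4 + κ₁) * (π * Real.sqrt 2) / (B.Dtmin - κ₁)) + (4 + κ₁) * (π * Real.sqrt 2)) / (B.Dtmin - κ₁)) + 2 * ((4 + κ₁) * (π * Real.sqrt 2) / (B.Dtmin - κ₁)) + π * Real.sqrt 2))) :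
    ∑ k ∈ (Finset.range N).filter (fun k : ℕ => |(k : ℝ) * w - π| ≤ τ), ((((Finset.range N).filter fun i : ℕ =>
        |hfunE δ u μ P (w / 2 + i * w) (w / 2 + i * w + k * w)| ≤ δ₀ + δ₁ * |(k : ℝ) * w - π| ∧
        |h3E δ u P (w / 2 + i * w) (w / 2 + i * w + k * w)| < lam ∧
        |h3E δ u P (w / 2 + i * w + k * w) (w / 2 + i * w)| < lam).card : ℝ)) ≤
      N + 2 * (2 * π / min (η₀ / (2 * ((4 + κ₁) * ((((4 + κ₂) * (B.smax + κ₁ * (π * Real.sqrt 2 + 2 * B.smax) / (B.Dtmin - κ₁)) ^ 2 + (8 + 2 * κ₁) * ((4 + κ₁) * (π * Real.sqrt 2) / (B.Dtmin - κ₁)) + (4 + κ₁) * (π * Real.sqrt 2)) / (B.Dtmin - κ₁)) + 2 * ((4 + κ₁) * (π * Real.sqrt 2) / (B.Dtmin - κ₁)) + π * Real.sqrt 2) * τ))) (lam / (8 * (B.smax + κ₁ * (π * Real.sqrt 2 + 2 * B.smax) / (B.Dtmin - κ₁)) ^ 2 + 2 * (κ₂ * (B.smax + κ₁ * (π * Real.sqrt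 2 + 2 * B.smax) / (B.Dtmin - κ₁)) ^ 2) + 4 * ((((4 + κ₂) * (B.smax + κ₁ * (π * Real.sqrt 2 + 2 * B.smax) / (B.Dtmin - κ₁)) ^ 2 + (8 + 2 * κ₁) * ((4 + κ₁) * (π * Real.sqrt 2) / (B.Dtmin - κ₁)) + (4 + κ₁) * (π * Real.sqrt 2)) / (B.Dtmin - κ₁)) + 2 * ((4 + κ₁) * (π * Real.sqrt 2) / (B.Dtmin - κ₁)) + π * Real.sqrt 2) + κ₁ * ((((4 + κ₂) * (B.smax + κ₁ * (π * Real.sqrt 2 + 2 * B.smax) / (B.Dtmin - κ₁)) ^ 2 + (8 + 2 * κ₁) * ((4 + κ₁) * (π * Real.sqrt 2) / (B.Dtmin - κ₁)) + (4 + κ₁) * (π * Real.sqrt 2)) / (B.Dtmin - κ₁)) + 2 * ((4 + κ₁) * (π * Real.sqrt 2) / (B.Dtmin - κ₁)) + π * Real.sqrt 2))) + 1) *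
        ((2 * δ₀ / (B.hmin / 2 * w)) * (2 * (1 + Real.log N)) / w + (2 * δ₁ / (B.hmin / 2 * w)) * N + N) := by
  have hh := B.hmin_pos
  have hκ₁0 : 0 ≤ κ₁ := (norm_nonneg _).trans (hκ 0)
  have hNh0 : 0 < Nh := by
    rcases Nat.eq_zero_or_pos Nh with h0 | h0
    · exfalso; rw [h0] at hNh; simp at hNh; linarith [Real.pi_pos]
    · exact h0
  have hNhN : Nh < N := by omega
  set S := (Finset.range N).filter (fun k : ℕ => |(k : ℝ) * w - π| ≤ τ) with hS
  set f : ℕ → ℝ := fun k => ((((Finset.range N).filter fun i : ℕ =>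
        |hfunE δ u μ P (w / 2 + i * w) (w / 2 + i * w + k * w)| ≤ δ₀ + δ₁ * |(k : ℝ) * w - π| ∧
        |h3E δ u P (w / 2 + i * w) (w / 2 + i * w + k * w)| < lam ∧
        |h3E δ u P (w / 2 + i * w + k * w) (w / 2 + i * w)| < lam).card : ℝ)) with hf
  have hf0 : ∀ k, 0 ≤ f k := fun k => by positivity
  have hfN : ∀ k, f k ≤ N := by
    intro k
    rw [hf]; dsimp only
    have := Finset.card_filter_le (Finset.range N) (fun i : ℕ =>
        |hfunE δ u μ P (w / 2 + i * w) (w / 2 + i * w + k * w)| ≤ δ₀ + δ₁ * |(k : ℝ) * w - π| ∧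
        |h3E δ u P (w / 2 + i * w) (w / 2 + i * w + k * w)| < lam ∧
        |h3E δ u P (w / 2 + i * w + k * w) (w / 2 + i * w)| < lam)
    rw [Finset.card_range] at this
    exact_mod_cast this
  rw [← Finset.sum_filter_add_sum_filter_not S (fun k : ℕ => k = Nh)]
  have htriv : ∑ k ∈ S.filter (fun k : ℕ => k = Nh), f k ≤ N := by
    have hsub : S.filter (fun k : ℕ => k = Nh) ⊆ {Nh} := by
      intro k hk
      rw [Finset.mem_filter] at hk
      rw [Finset.mem_singleton]; exact hk.2
    calc ∑ k ∈ S.filter (fun k : ℕ => k = Nh), f k ≤ ∑ k ∈ ({Nh} : Finset ℕ), f k :=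
          Finset.sum_le_sum_of_subset_of_nonneg hsub fun k _ _ => hf0 k
      _ = f Nh := Finset.sum_singleton _ _
      _ ≤ N := hfN Nh
  have hgood : ∑ k ∈ S.filter (fun k : ℕ => ¬ k = Nh), f k ≤
      2 * (2 * π / min (η₀ / (2 * ((4 + κ₁) * ((((4 + κ₂) * (B.smax + κ₁ * (π * Real.sqrt 2 + 2 * B.smax) / (B.Dtmin - κ₁)) ^ 2 + (8 + 2 * κ₁) * ((4 + κ₁) * (π * Real.sqrt 2) / (B.Dtmin - κ₁)) + (4 + κ₁) * (π * Real.sqrt 2)) / (B.Dtmin - κ₁)) + 2 * ((4 + κ₁) * (π * Real.sqrt 2) / (B.Dtmin - κ₁)) + π * Real.sqrt 2) * τ))) (lam / (8 * (B.smax + κ₁ * (π * Real.sqrt 2 + 2 * B.smax) / (B.Dtmin - κ₁)) ^ 2 + 2 * (κ₂ * (B.smax + κ₁ * (π * Real.sqrt 2 + 2 * B.smax) / (B.Dtmin - κ₁)) ^ 2) + 4 * ((((4 + κ₂) * (B.smax + κ₁ * (π * Real.sqrt 2 + 2 * B.smax) / (B.Dtmin - κ₁)) ^ 2 + (8 + 2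 * κ₁) * ((4 + κ₁) * (π * Real.sqrt 2) / (B.Dtmin - κ₁)) + (4 + κ₁) * (π * Real.sqrt 2)) / (B.Dtmin - κ₁)) + 2 * ((4 + κ₁) * (π * Real.sqrt 2) / (B.Dtmin - κ₁)) + π * Real.sqrt 2) + κ₁ * ((((4 + κ₂) * (B.smax + κ₁ * (π * Real.sqrt 2 + 2 * B.smax) / (B.Dtmin - κ₁)) ^ 2 + (8 + 2 * κ₁) * ((4 + κ₁) * (π * Real.sqrt 2) / (B.Dtmin - κ₁)) + (4 + κ₁) * (π * Real.sqrt 2)) / (B.Dtmin - κ₁)) + 2 * ((4 + κ₁) * (π * Real.sqrt 2) / (B.Dtmin - κ₁)) + π * Real.sqrt 2))) + 1) *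
        ((2 * δ₀ / (B.hmin / 2 * w)) * (2 * (1 + Real.log N)) / w + (2 * δ₁ / (B.hmin / 2 * w)) * N + N) := by
    set C₅ := 2 * π / min (η₀ / (2 * ((4 + κ₁) * ((((4 + κ₂) * (B.smax + κ₁ * (π * Real.sqrt 2 + 2 * B.smax) / (B.Dtmin - κ₁)) ^ 2 + (8 + 2 * κ₁) * ((4 + κ₁) * (π * Real.sqrt 2) / (B.Dtmin - κ₁)) + (4 + κ₁) * (π * Real.sqrt 2)) / (B.Dtmin - κ₁)) + 2 * ((4 + κ₁) * (π * Real.sqrt 2) / (B.Dtmin - κ₁)) + π * Real.sqrt 2) * τ))) (lam / (8 * (B.smax + κ₁ * (π * Real.sqrt 2 + 2 * B.smax) / (B.Dtmin - κ₁)) ^ 2 + 2 * (κ₂ * (B.smax + κ₁ * (π * Real.sqrt 2 + 2 * B.smax) / (B.Dtmin - κ₁)) ^ 2) + 4 * ((((4 + κ₂) * (B.smax + κ₁ * (π * Real.sqrt 2 + 2 * B.smax) / (B.Dtmin - κ₁)) ^ 2 + (8 + 2 * κ₁) * ((4 + κ₁) * (π * Real.sqrt 2) / (B.Dtmin - κ₁))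 + (4 + κ₁) * (π * Real.sqrt 2)) / (B.Dtmin - κ₁)) + 2 * ((4 + κ₁) * (π * Real.sqrt 2) / (B.Dtmin - κ₁)) + π * Real.sqrt 2) + κ₁ * ((((4 + κ₂) * (B.smax + κ₁ * (π * Real.sqrt 2 + 2 * B.smax) / (B.Dtmin - κ₁)) ^ 2 + (8 + 2 * κ₁) * ((4 + κ₁) * (π * Real.sqrt 2) / (B.Dtmin - κ₁)) + (4 + κ₁) * (π * Real.sqrt 2)) / (B.Dtmin - κ₁)) + 2 * ((4 + κ₁) * (π * Real.sqrt 2) / (B.Dtmin - κ₁)) + π * Real.sqrt 2))) + 1 with hC₅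
    have hℓ : 0 < min (η₀ / (2 * ((4 + κ₁) * ((((4 + κ₂) * (B.smax + κ₁ * (π * Real.sqrt 2 + 2 * B.smax) / (B.Dtmin - κ₁)) ^ 2 + (8 + 2 * κ₁) * ((4 + κ₁) * (π * Real.sqrt 2) / (B.Dtmin - κ₁)) + (4 + κ₁) * (π * Real.sqrt 2)) / (B.Dtmin - κ₁)) + 2 * ((4 + κ₁) * (π * Real.sqrt 2) / (B.Dtmin - κ₁)) + π * Real.sqrt 2) * τ))) (lam / (8 * (B.smax + κ₁ * (π * Real.sqrt 2 + 2 * B.smax) / (B.Dtmin - κ₁)) ^ 2 + 2 * (κ₂ * (B.smax + κ₁ * (π * Real.sqrt 2 + 2 * B.smax) / (B.Dtmin - κ₁)) ^ 2) + 4 * ((((4 + κ₂) * (B.smax + κ₁ * (π * Real.sqrt 2 + 2 * B.smax) / (B.Dtmin - κ₁)) ^ 2 + (8 + 2 * κ₁) * ((4 + κ₁) * (π * Real.sqrt 2) / (B.Dtmin - κ₁)) + (4 + κ₁) * (π * Real.sqrt 2)) / (B.Dtmin - κ₁)) + 2 * ((4 + κ₁) * (π * Real.sqrt 2) / (B.Dtmin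 - κ₁)) + π * Real.sqrt 2) + κ₁ * ((((4 + κ₂) * (B.smax + κ₁ * (π * Real.sqrt 2 + 2 * B.smax) / (B.Dtmin - κ₁)) ^ 2 + (8 + 2 * κ₁) * ((4 + κ₁) * (π * Real.sqrt 2) / (B.Dtmin - κ₁)) + (4 + κ₁) * (π * Real.sqrt 2)) / (B.Dtmin - κ₁)) + 2 * ((4 + κ₁) * (π * Real.sqrt 2) / (B.Dtmin - κ₁)) + π * Real.sqrt 2))) :=
      lt_min (by positivity) (by positivity)
    have hC₅0 : 0 ≤ C₅ := by positivity
    have hterm : ∀ k ∈ S.filter (fun k : ℕ => ¬ k = Nh),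
        f k ≤ C₅ * (2 * ((2 * δ₀ / (B.hmin / 2 * w)) * (1 / |(k : ℝ) - Nh|) / w + 2 * δ₁ / (B.hmin / 2 * w) + 1)) := by
      intro k hk
      rw [Finset.mem_filter, hS, Finset.mem_filter, Finset.mem_range] at hk
      obtain ⟨⟨hkN, hkτ⟩, hkNh⟩ := hk
      have hkey : |(k : ℝ) * w - π| = |(k : ℝ) - Nh| * w := by
        rw [← hNh, show (k : ℝ) * w - Nh * w = ((k : ℝ) - Nh) * w by ring, abs_mul, abs_of_pos hw]
      have hkNh' : (k : ℝ) - Nh ≠ 0 := by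
        intro h0
        have : (k : ℝ) = Nh := by linarith
        exact hkNh (by exact_mod_cast this)
      have habs : |(k : ℝ) - Nh| ≠ 0 := abs_ne_zero.2 hkNh'
      have hcpos : 0 < |(k : ℝ) * w - π| := by rw [hkey]; positivity
      -- the shift's own tolerance
      set δk := δ₀ + δ₁ * |(k : ℝ) * w - π| with hδk
      have hδk0 : 0 ≤ δk := by positivity
      have hδkη : δk ≤ η₀ / 2 := by
        have : δ₁ * |(k : ℝ) * w - π| ≤ δ₁ * τ := mul_le_mul_of_nonneg_left hkτ hδ₁
        rw [hδk]; linarith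
      have hmono : f k ≤ ((((Finset.range N).filter fun i : ℕ =>
          |hfunE δ u μ P (w / 2 + i * w) (w / 2 + i * w + k * w)| ≤ δk ∧
          |h3E δ u P (w / 2 + i * w + k * w) (w / 2 + i * w)| ≤ lam).card : ℝ)) := by
        rw [hf]; dsimp only
        have hsub' : ((Finset.range N).filter fun i : ℕ =>
            |hfunE δ u μ P (w / 2 + i * w) (w / 2 + i * w + k * w)| ≤ δ₀ + δ₁ * |(k : ℝ) * w - π| ∧
            |h3E δ u P (w / 2 + i * w) (w / 2 + i * w + k * w)| < lam ∧
            |h3E δ u P (w / 2 + i * w + k * w) (w / 2 + i * w)| < lam) ⊆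
            ((Finset.range N).filter fun i : ℕ =>
              |hfunE δ u μ P (w / 2 + i * w) (w / 2 + i * w + k * w)| ≤ δk ∧
              |h3E δ u P (w / 2 + i * w + k * w) (w / 2 + i * w)| ≤ lam) := by
          intro i hi
          rw [Finset.mem_filter] at hi ⊢
          exact ⟨hi.1, hi.2.1, hi.2.2.2.le⟩
        exact_mod_cast Finset.card_le_card hsub'
      have hL := count_odd_shift_perturbed B hδs heven hδ hlo hhi hκ hκ₁ hκ₂ hu (P := P) hw hN hδk0 hη₀ hlam hτ hδkη hlo' hhi' hkτ
        hcpos hsmall hκA hAE hMΓ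
      refine hmono.trans (hL.trans (le_of_eq ?_))
      rw [hδk, hkey, hC₅]
      field_simp
    have hsub : S.filter (fun k : ℕ => ¬ k = Nh) ⊆ (Finset.range N).filter (fun k => k ≠ Nh) := by
      intro k hk
      rw [Finset.mem_filter, hS, Finset.mem_filter] at hk
      rw [Finset.mem_filter]
      exact ⟨hk.1.1, hk.2⟩
    calc ∑ k ∈ S.filter (fun k : ℕ => ¬ k = Nh), f k
        ≤ ∑ k ∈ S.filter (fun k : ℕ => ¬ k = Nh),
            C₅ * (2 * ((2 * δ₀ / (B.hmin / 2 * w)) * (1 / |(k : ℝ) - Nh|) / w + 2 * δ₁ / (B.hmin / 2 * w) + 1)) :=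
          Finset.sum_le_sum hterm
      _ ≤ ∑ k ∈ (Finset.range N).filter (fun k => k ≠ Nh),
            C₅ * (2 * ((2 * δ₀ / (B.hmin / 2 * w)) * (1 / |(k : ℝ) - Nh|) / w + 2 * δ₁ / (B.hmin / 2 * w) + 1)) :=
          Finset.sum_le_sum_of_subset_of_nonneg hsub fun k _ _ => by positivity
      _ = (2 * C₅ * (2 * δ₀ / (B.hmin / 2 * w)) / w) * ∑ k ∈ (Finset.range N).filter (fun k => k ≠ Nh), 1 / |(k : ℝ) - Nh|
            + 2 * C₅ * (2 * δ₁ / (B.hmin / 2 * w) + 1) * (((Finset.range N).filter (fun k => k ≠ Nh)).card : ℝ) := by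
          have hrw : ∀ k : ℕ, C₅ * (2 * ((2 * δ₀ / (B.hmin / 2 * w)) * (1 / |(k : ℝ) - Nh|) / w + 2 * δ₁ / (B.hmin / 2 * w) + 1)) =
              (2 * C₅ * (2 * δ₀ / (B.hmin / 2 * w)) / w) * (1 / |(k : ℝ) - Nh|) + 2 * C₅ * (2 * δ₁ / (B.hmin / 2 * w) + 1) := by
            intro k; ring
          rw [Finset.sum_congr rfl (fun k _ => hrw k), Finset.sum_add_distrib, ← Finset.mul_sum, Finset.sum_const,
            nsmul_eq_mul]
          ring
      _ ≤ (2 * C₅ * (2 * δ₀ / (B.hmin / 2 * w)) / w) * (2 * (1 + Real.log N)) + 2 * C₅ * (2 * δ₁ / (B.hmin / 2 * w) + 1) * N := by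
          apply add_le_add
          · exact mul_le_mul_of_nonneg_left (sum_inv_abs_sub_le hNhN) (by positivity)
          · apply mul_le_mul_of_nonneg_left _ (by positivity)
            calc ((((Finset.range N).filter (fun k => k ≠ Nh)).card : ℝ)) ≤ ((Finset.range N).card : ℝ) := by
                  exact_mod_cast Finset.card_filter_le _ _
              _ = N := by rw [Finset.card_range]
      _ = 2 * C₅ * ((2 * δ₀ / (B.hmin / 2 * w)) * (2 * (1 + Real.log N)) / w + (2 * δ₁ / (B.hmin / 2 * w)) * N + N) := by ring
  linarith

end ShiftThin

end Summit.HubbardSuperconductivity.HubbardSuperconductivity.Theorems.PerturbedFermiCurve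

end
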